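import Literature.AnabelianGeometry.EtaleTheta.ThetaCoversTemperedModelHeis
import Literature.AnabelianGeometry.EtaleTheta.Discharge.Sec2TemperedCoverDataModel
import Mathlib.GroupTheory.Commutator.Basic
import HarnessLib

/-!
# The HEISENBERG variant of the `TemperedCoverData` model: `hΘ` and `K ⊇ μ_l` HOLD, the cusp count of [EtTh] Cor. 2.9 still
# FAILS — proof-only sequel of `ThetaCoversTemperedModelHeis.lean` (inhabitant + sharpened certificate for G-L2d3-1 / G-L2d3-2)

S. Mochizuki, *The étale theta function …*, Publ. RIMS **45** (2009) [MochizukiEtTh2009], §1 p.238 (PDF p.12), §2 Def. 2.1 – 2.5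
(PDF pp.36–40), Rmk. 2.6.1 p.266, Cor. 2.9 p.269.  abc-iut cell, layer L2, seat abc-iut-w5-d118.  PROOF-ONLY (0 definitions).

For the Heisenberg variant `TemperedModel.coverDataAxH` (`Ker(Δ_X ↠ Δ̄_X) := Ker Φ`, `Δ̄_X ≅` the mod-`l` Heisenberg group):
* `isMinusEigen_EH`, `isTypeLTorsThetaPm_PiCuuH` — the Def. 2.3 datum `Π_C̲̲ := (Ker Φ · Φ⁻¹(heisE)) · ⟨ι̲⟩` is of type
  `(1, l-torsΘ)±` (the toy's Prop. 2.2 data of abc-iut-w5-d243 pulled back along the surjection `Φ`);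
* `hTheta_H` — **`⁅Δ_X, Δ_X⁆ · Ker = Δ̄_Θ-preimage` HOLDS** (`Φ⁻¹⁅heisPiX, heisPiX⁆ = ⁅Π_X, Π_X⁆ · Ker Φ`, Mathlib `map_commutator` /
  `comap_map_eq`, and the toy's `commutator_sup_barKer`): the v-next field `commutator_sup_barKer` of GAP-LEDGER G-L2d3-1 (census
  S2-3) is JOINTLY SATISFIABLE with the whole tempered interface, binder-free;
* `exists_model_hTheta` — a `TemperedCoverData l` (same tempered layer `A × ℤ ↪ Â × Ẑ` as `Sec2TemperedCoverDataModel.lean`) with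
  `hΘ ∧ HasMuL ∧ cuspStabC = ⊤ ∧ ¬hC1 ∧ (one orbit of cusps)`; hence `not_forall_cor29_card_of_hTheta`: **even granted `hΘ`,
  the typed `Cor29_card` is not a consequence of `TemperedCoverData`** — the failure isolated in the CUSP data (G-L2d3-2) alone.
HONEST FRAMING: consistency/independence statements about OUR interface; degenerate model (`G_K = 1`); nothing printed is refuted;
no side taken on [IUTchIII] Cor. 3.12; typed ≠ proved.
-/

noncomputable section

namespace Literature.AnabelianGeometry.EtaleTheta

namespace ThetaCovers

namespace TemperedModel

open Multiplicative HeisenbergWitness Literature.AnabelianGeometry.SemiGraphs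
  Literature.AnabelianGeometry.EtaleTheta.SettingModel
open scoped commutatorElement

variable (l : ℕ) [NeZero l]

/-! ## 1. The `(1, l-torsΘ)±` datum of the Heisenberg variant -/

/-- `Π_C̲` is of type `(1, l-tors)±` for the Heisenberg variant too (the predicate does not involve `Ker`; same proof term as
`isTypeLTorsPm_HpM`). [cite: MochizukiEtTh2009, Def 2.1 p.36] -/
theorem isTypeLTorsPm_HpM_H (hl : Odd l) : (coverDataAxH l hl).toCoverData.IsTypeLTorsPm (HpM l) := by
  have h := isTypeLTorsPm_HpM l hl
  exact ⟨⟨h.inf_isTypeLTors.le, h.inf_isTypeLTors.quot, h.inf_isTypeLTors.barTheta_le, h.inf_isTypeLTors.delta_sup,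
    h.inf_isTypeLTors.Dx_le⟩, h.relIndex_two⟩

/-- `ι̲` is an inversion for `Π_C̲` (Heisenberg variant; same term). [cite: MochizukiEtTh2009, Prop 2.2 p.36] -/
theorem isInversion_iotaM_H (hl : Odd l) : (coverDataAxH l hl).toCoverData.IsInversion (HpM l) (iotaM l) := by
  have h := isInversion_iotaM l hl
  exact ⟨h.mem, h.mem_delta, h.not_mem⟩

omit [NeZero l] in
/-- In the toy, `E · Δ̄_Θ = Π_X̲` (`heisE ⊔ heisTheta = heisPiCu ⊓ heisPiX`). (toy bookkeeping) [cite: MochizukiEtTh2009, Prop 2.2 (i) p.37] -/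
theorem heisE_sup_heisTheta (hl : Odd l) : heisE l ⊔ heisTheta l = heisPiCu l ⊓ heisPiX l := by
  have h := (isMinusEigen_heisE l hl).sup_eq
  change heisE l ⊔ heisTheta l = (heisPiCu l ⊓ heisPiX l) ⊓ (1 : heisPiC l →* PUnit.{1}).ker at h
  rwa [MonoidHom.ker_one, inf_top_eq] at h

/-- **`E := Φ⁻¹(heisE)` is the `(−1)`-eigenspace datum `Im(s_ι)`** for `(Π_X̲, Π_C̲, ι̲)` in the Heisenberg variant — the toy's
`isMinusEigen_heisE` pulled back along the surjection `Φ`. [cite: MochizukiEtTh2009, Prop 2.2 (i) p.37] -/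
theorem isMinusEigen_EH (hl : Odd l) :
    (coverDataAxH l hl).toCoverData.IsMinusEigen (HpM l ⊓ PiXM l) (HpM l) (iotaM l) (EH l) := by
  have toy := isMinusEigen_heisE l hl
  have hsnot : (SemidirectProduct.inr (DihedralGroup.sr 0) : heisPiC l) ∉ heisPiX l := fun h => by
    obtain ⟨i, hi⟩ := (mem_heisPiX l).mp h; cases hi
  refine ⟨?_, ?_, ?_, ?_, ?_, ?_, ?_, ?_⟩
  · -- `Ker Φ ⊆ E`
    change (Phi l).ker ≤ (heisE l).comap (Phi l)
    rw [← MonoidHom.comap_bot]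
    exact Subgroup.comap_mono bot_le
  · -- `E ⊆ Π_X̲ ∩ Δ_C`
    change EH l ≤ (HpM l ⊓ PiXM l) ⊓ (1 : PiCM l →* PUnit.{1}).ker
    rw [MonoidHom.ker_one, inf_top_eq]
    intro x hx
    exact (mem_HpM_inf_iff l x).mpr ((mem_heisE l).mp hx).1
  · -- normalised by `Π_X̲`
    intro g hg e he
    change Phi l (g * e * g⁻¹) ∈ heisE l
    rw [map_mul, map_mul, map_inv]
    exact toy.conj_mem (Phi l g) hg (Phi l e) he
  · -- `E ∩ Δ̄_Θ = Ker Φ`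
    change (heisE l).comap (Phi l) ⊓ (heisTheta l).comap (Phi l) = (Phi l).ker
    rw [← Subgroup.comap_inf, ← MonoidHom.comap_bot]
    exact congrArg (Subgroup.comap (Phi l)) toy.inf_eq
  · -- `E · Δ̄_Θ = Π_X̲ ∩ Δ_C`
    change (heisE l).comap (Phi l) ⊔ (heisTheta l).comap (Phi l) = (HpM l ⊓ PiXM l) ⊓ (1 : PiCM l →* PUnit.{1}).ker
    rw [MonoidHom.ker_one, inf_top_eq, Subgroup.comap_sup_eq (Phi l) _ _ (Phi_surjective l), heisE_sup_heisTheta l hl]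
    exact (HpM_inf_eq l).symm
  · -- `ι̲` acts by `−1` on `E / Ker`
    intro e he
    rw [MonoidHom.mem_ker, map_mul, map_mul, map_mul, map_inv, Phi_iotaM]
    exact Subgroup.mem_bot.mp (toy.minus (Phi l e) he)
  · -- `ι̲` acts by `+1` on `Δ̄_Θ`
    intro t ht
    rw [MonoidHom.mem_ker, map_mul, map_mul, map_mul, map_inv, map_inv, Phi_iotaM]
    exact heis_inv_theta l hl hsnot ht
  · -- `ι̲` normalises `E`
    intro e he
    change Phi l (iotaM l * e * (iotaM l)⁻¹) ∈ heisE l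
    rw [map_mul, map_mul, map_inv, Phi_iotaM]
    exact toy.iota_conj (Phi l e) he

/-- `S := Ker Φ` is a splitting of `D̄_x ↠ G_K = 1` (Heisenberg variant). [cite: MochizukiEtTh2009, Prop 2.2 (ii) p.37] -/
theorem isSplitting_kerPhi (hl : Odd l) : (coverDataAxH l hl).toCoverData.IsSplitting (Phi l).ker :=
  ⟨le_rfl, le_sup_right, inf_eq_left.mpr (by rw [← MonoidHom.comap_bot]; exact Subgroup.comap_mono bot_le),
    fun _ => ⟨1, Subsingleton.elim _ _⟩⟩

/-- **`Π_C̲̲ := (Ker Φ · E) · ⟨ι̲⟩` is of type `(1, l-torsΘ)±`** in the Heisenberg variant. [cite: MochizukiEtTh2009, Def 2.3 p.38] -/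
theorem isTypeLTorsThetaPm_PiCuuH (hl : Odd l) : (coverDataAxH l hl).toCoverData.IsTypeLTorsThetaPm (PiCuuH l) :=
  ⟨HpM l, EH l, (Phi l).ker, iotaM l, isTypeLTorsPm_HpM_H l hl, isInversion_iotaM_H l hl,
    by rw [iotaM_mul_self]; exact (Phi l).ker.one_mem, isMinusEigen_EH l hl, isSplitting_kerPhi l hl, rfl⟩

/-- `Π_C̲̲ ⊆ Π_C̲` (Heisenberg variant). [cite: MochizukiEtTh2009, Def 2.3 p.38] -/
theorem PiCuuH_le_HpM : PiCuuH l ≤ HpM l := by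
  have hι : iotaM l ∈ HpM l := by
    change Phi l (iotaM l) ∈ heisPiCu l
    rw [Phi_iotaM]
    exact Or.inr rfl
  refine sup_le (sup_le ?_ ?_) (by rw [Subgroup.zpowers_le]; exact hι)
  · intro x hx
    change Phi l x ∈ heisPiCu l
    rw [(MonoidHom.mem_ker).mp hx]
    exact (heisPiCu l).one_mem
  · intro x hx
    exact ((mem_HpM_inf_iff l x).mpr ((mem_heisE l).mp hx).1).1

/-! ## 2. `hΘ` and `K ⊇ μ_l` hold in the Heisenberg variant -/

omit [NeZero l] in
/-- In the toy, `⁅heisPiX, heisPiX⁆ = heisTheta` (the commutator subgroup of the mod-`l` Heisenberg group is its centre).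
(toy bookkeeping) [cite: MochizukiEtTh2009, Rmk 2.6.1 p.40] -/
theorem commutator_heisPiX (hl : Odd l) : ⁅heisPiX l, heisPiX l⁆ = heisTheta l := by
  have h := commutator_sup_barKer l hl
  change ⁅heisPiX l ⊓ (1 : heisPiC l →* PUnit.{1}).ker, heisPiX l ⊓ (1 : heisPiC l →* PUnit.{1}).ker⁆ ⊔ ⊥ = heisTheta l at h
  rwa [MonoidHom.ker_one, inf_top_eq, sup_bot_eq] at h

/-- **`hΘ` HOLDS in the Heisenberg variant**: `⁅Δ_X, Δ_X⁆ · Ker(Δ_X ↠ Δ̄_X) = Δ̄_Θ-preimage` — the binder of GAP-LEDGER G-L2d3-1 /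
the v-next field `commutator_sup_barKer` is satisfied by a binder-free model. [cite: MochizukiEtTh2009, Rmk 2.6.1 p.40] -/
theorem hTheta_H (hl : Odd l) :
    ⁅(coverDataAxH l hl).toCoverData.DeltaX, (coverDataAxH l hl).toCoverData.DeltaX⁆ ⊔ (coverDataAxH l hl).barKer =
      (coverDataAxH l hl).barTheta := by
  change ⁅PiXM l ⊓ (1 : PiCM l →* PUnit.{1}).ker, PiXM l ⊓ (1 : PiCM l →* PUnit.{1}).ker⁆ ⊔ (Phi l).ker = barThetaM l
  rw [MonoidHom.ker_one, inf_top_eq, ← Subgroup.comap_map_eq, Subgroup.map_commutator, PiXM,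
    Subgroup.map_comap_eq_self_of_surjective (Phi_surjective l), commutator_heisPiX l hl]
  rfl

/-- **`K ⊇ μ_l` (`HasMuL`) holds in the Heisenberg variant**: `Δ̄_Θ = heisTheta` is central in the whole toy group.
[cite: MochizukiEtTh2009, Cor 2.9 p.43] -/
theorem hasMuL_H (hl : Odd l) (c : PiCM l) {t : PiCM l} (ht : t ∈ barThetaM l) : c * t * c⁻¹ * t⁻¹ ∈ (Phi l).ker := by
  rw [MonoidHom.mem_ker, map_mul, map_mul, map_mul, map_inv, map_inv]
  exact heis_theta_central l hl (Phi l c) ht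

/-! ## 3. The inhabitant with `hΘ`, and the sharpened certificate -/

/-- **A `TemperedCoverData l` satisfying `hΘ` and `K ⊇ μ_l`, binder-free** (the Heisenberg variant, same tempered layer
`A × ℤ ↪ Â × Ẑ` as `exists_model`), at which nevertheless `cuspStabC = Π^tp_C`, the cusp hypothesis `hC1` FAILS and every member
has ONE orbit of cusps. [cite: MochizukiEtTh2009, Cor 2.9 p.43] -/
theorem exists_model_hTheta (hl : Odd l) (hl1 : l ≠ 1) : ∃ T : TemperedCoverData.{0} l,
    ⁅T.toCoverData.DeltaX, T.toCoverData.DeltaX⁆ ⊔ T.barKer = T.barTheta ∧ T.HasMuL ∧ T.cuspStabC = ⊤ ∧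
      ¬ (T.cuspStabC ⊓ T.tp T.PiX ≤ T.tp T.PiXu) ∧ ∀ S : Subgroup T.Gtp, Nat.card (T.cuspOrbits S) = 1 := by
  haveI := TAX_normal l
  haveI : ((TAX l).prod (⊥ : Subgroup (Multiplicative ℤ))).Normal := Subgroup.prod_normal _ _
  let T : TemperedCoverData.{0} l :=
    { toCoverDataAx := coverDataAxH l hl
      PiCuu := PiCuuH l
      isTypeLTorsThetaPm := isTypeLTorsThetaPm_PiCuuH l hl
      isOpen_PiCuu' := by
        -- `Π_C̲̲ ⊇ E = Φ⁻¹(heisE)`, an open subgroup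
        have hE : IsOpen (EH l : Set (PiCM l)) := by
          change IsOpen ((Phi l) ⁻¹' (heisE l : Set (heisPiC l)))
          exact isOpen_preimage_Phi l _
        exact Subgroup.isOpen_mono (le_sup_right.trans le_sup_left) hE
      Gtp := GtpM l
      toHat := (toHatM l).toMonoidHom
      continuous_toHat := (toHatM l).continuous
      injective_toHat := toHatM_injective l
      isProfiniteCompletion_toHat := isProfiniteCompletion_prodMap_etaCont (TA l) (Multiplicative ℤ)
      PiYtp := (TAX l).prod ⊥
      PiYtp_le := by
        change (TAX l).prod ⊥ ≤ (PiXM l).comap (toHatM l).toMonoidHom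
        rw [comap_toHatM_PiXM]
        exact Subgroup.prod_mono le_rfl bot_le
      PiYtp_normal := inferInstance
      isOpen_PiYtp := isOpen_discrete _
      quotZ := nonempty_quotZ l
      PiYddtp := ((TAX l ⊓ (TA.two l).ker)).prod ⊥
      PiYddtp_le := Subgroup.prod_mono inf_le_left le_rfl
      isOpen_PiYddtp := isOpen_discrete _
      relIndex_PiYddtp := relIndex_PiYddtp l
      PiCdot := ((TA.two l).ker).prod ⊤
      index_PiCdot := index_PiCdot l
      isOpen_PiCdot := isOpen_discrete _
      PiCdot_ne := PiCdot_ne l }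
  have hN : (T.tp T.Dx).Normal := by
    change ((barThetaM l).comap (toHatM l).toMonoidHom).Normal
    haveI := barThetaM_normal l
    exact Subgroup.Normal.comap inferInstance _
  have hstab : T.cuspStabC = ⊤ := by
    change Subgroup.normalizer ((T.tp T.Dx : Subgroup T.Gtp) : Set T.Gtp) = ⊤
    exact Subgroup.normalizer_eq_top_iff.mpr hN
  have hgX : (TA.mk l (SemidirectProduct.inr (DihedralGroup.r 1)) 1, (1 : Multiplicative ℤ)) ∈ T.tp T.PiX := by
    change _ ∈ (PiXM l).comap (toHatM l).toMonoidHom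
    rw [mem_comap_toHatM_PiXM]
    exact (mem_heisPiX l).mpr ⟨1, rfl⟩
  have hgU : (TA.mk l (SemidirectProduct.inr (DihedralGroup.r 1)) 1, (1 : Multiplicative ℤ)) ∉ T.tp T.PiXu := by
    intro h
    have hle : T.PiXu ≤ HpM l :=
      sup_le (inf_le_left.trans (PiCuuH_le_HpM l)) ((barThetaM_le_HpM_inf l).trans inf_le_left)
    exact rotOne_not_mem_HpM l hl1 (hle h)
  refine ⟨T, hTheta_H l hl, fun c t ht => hasMuL_H l hl c ht, hstab, ?_, fun S => ?_⟩
  · rw [hstab, top_inf_eq]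
    exact fun h => hgU (h hgX)
  · haveI : Subsingleton (T.cuspOrbits S) := by
      refine ⟨fun a b => ?_⟩
      induction a using Quotient.inductionOn with
      | _ a =>
        induction b using Quotient.inductionOn with
        | _ b =>
          refine (DoubleCoset.eq _ _ a b).mpr ⟨1, Subgroup.one_mem _, a⁻¹ * b, ?_, by group⟩
          rw [hstab]
          trivial
    exact Nat.card_unique

/-- **SHARPENED INDEPENDENCE CERTIFICATE (G-L2d3-2 given G-L2d3-1)**: even for tempered cover data satisfying `hΘ` (the printed
definition of `Δ̄_Θ` as the commutator image), the typed `Cor29_card` is NOT a consequence of `ThetaCovers.TemperedCoverData` (`l ≥ 3`)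
— the failure sits in the CUSP data (no `D^tp_{x_C}` fields), not in `hΘ`. [cite: MochizukiEtTh2009, Cor 2.9 p.43] -/
theorem not_forall_cor29_card_of_hTheta (hl : Odd l) (h3 : 3 ≤ l) :
    ¬ ∀ T : TemperedCoverData.{0} l, ⁅T.toCoverData.DeltaX, T.toCoverData.DeltaX⁆ ⊔ T.barKer = T.barTheta → T.Cor29_card := by
  obtain ⟨T, hΘ, hmu, -, -, hone⟩ := exists_model_hTheta l hl (by omega)
  intro h
  have h2 := h T hΘ hmu (T.tp T.PiCu) (by simp)
  rw [hone] at h2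
  omega

end TemperedModel

end ThetaCovers

end Literature.AnabelianGeometry.EtaleTheta
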